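import Mathlib
import Summits.ResolutionOfSingularities.ResolutionOfSingularities.Theorems.WeightedInvariantLocalWeightedDropNCGameDecoratedWins

/-!
# `WeightedInvariant.LocalWeightedDrop`, the NC count game: RADICAL COMPANIONS — a move clause proved for a radical-equivalent germ `t` transports
# to the position `b`, successor by successor

Crux item stmt-ResolutionOfSingularities-8899 `LocalWeightedDrop` (route `ResolutionOfSingularities/WeightedInvariant`), ENGINE skeleton v32
(ddb48572591139d5), registered stub `stub_spaceNCRankDrop`; TOT2-LINE v1.2 (`L/res-L1-w43-lead-1/g4/TOT2-LINE.md`, g5 plan (g-a)).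
[OURS · L1 W4.3 · chain w43 · res-L1-w43-lead-1 gen 4; the one-germ form of the radical transport inside res-L1-w43-stub-1's S-SET
`admissible_transform` and of `winsOrd_of_dvd_pow` (…NCGameRank, p525270): positions of the NC count game are only RADICAL-EQUIVALENT to the
honest germs (`U · monic form · letters`) on which the regime theorems are proved (S-SET (A1)); this file lets a strategy computed on the honest
germ be played on the position, keeping an honest radical companion at every successor.  Nothing here is a statement of any manuscript;
AI-produced, gate-checked, weaker than expert review.  Definition-free.]

* `RadEq b t` is NOT defined (no definitions here): «`b ∣ t^(M+1) ∧ t ∣ b^(N+1)` for some `M N`» is spelled out.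
* **`MoveClause.of_radical`** — if `b ∣ t^(M+1)`, `t ∣ b^(N+1)`, `t ≠ 0` and `MoveClause t Φ w P` for a legal `(Φ, w)`, then
  `MoveClause b Φ w (b′ ↦ ∃ t′, b′, t′ radical-equivalent ∧ t′ ≠ 0 ∧ P t′)` (same slot, `successor_dvd_pow` both ways).
* **`DWinsTo.of_radical_measure`** — the measure form of decorated winning with radical companions: states carry `(b, t, data)`; if from every
  honest `t` of the class a legal move lowers an ordinal measure on the data at every honest successor (or reaches the target), then from every
  position `b` with an honest radical companion in the class the mover forces the target — read on `b`.
-/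

set_option linter.dupNamespace false -- mandated namespace of this single-conjunct summit

noncomputable section

namespace Summit.ResolutionOfSingularities.ResolutionOfSingularities.Theorems

namespace TameFourTupleDrop

open MvPowerSeries Literature.AlgebraicGeometry.Resolution

variable {k : Type} [Field k] {m : ℕ}

/-- **RADICAL TRANSPORT OF A MOVE CLAUSE.**  Let `b ∣ t^(M+1)` and `t ∣ b^(N+1)` (`b`, `t` have the same radical), `t ≠ 0`, and let the legal move
`(Φ, w)` satisfy the move clause from `t` with goodness `P`.  Then it satisfies the move clause from `b` with goodness «some radical-equivalent
non-zero `t′` is `P`-good»: at every answer the mover takes, for `b`, the slot it would take for `t`; the two successors are radical-equivalent by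
`successor_dvd_pow` (…NCGameRank) in both directions. -/
theorem MoveClause.of_radical {b t : MvPowerSeries (Fin (m + 1)) k} {M N : ℕ} (hbt : b ∣ t ^ (M + 1)) (htb : t ∣ b ^ (N + 1)) (ht : t ≠ 0)
    {Φ : Fin (m + 1) → MvPowerSeries (Fin (m + 1)) k} {w : Fin (m + 1) → ℕ} (hmv : IsCountMove Φ w)
    {P : MvPowerSeries (Fin (m + 1)) k → Prop} (h : MoveClause t Φ w P) :
    MoveClause b Φ w (fun b' => ∃ t' : MvPowerSeries (Fin (m + 1)) k,
      (∃ M' N' : ℕ, b' ∣ t' ^ (M' + 1) ∧ t' ∣ b' ^ (N' + 1)) ∧ t' ≠ 0 ∧ P t') := by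
  intro c hc hc0 Ab Gb hfacb hGb
  obtain ⟨hΦ0, hdet, hw1, -⟩ := hmv
  have hT : subst (CobordantChart.chart w c) (subst Φ t) ≠ 0 :=
    CobordantChart.subst_chart_ne_zero w c hc (FormalCoordChange.subst_ne_zero_of_isUnit_det hΦ0 hdet ht)
  obtain ⟨At, Gt, hfact, hGt⟩ := CobordantVertexChart.exists_eq_X_pow_mul_not_dvd hT
  obtain ⟨i, hci, hP⟩ := h c hc hc0 At Gt hfact hGt
  obtain ⟨q₁, hq₁⟩ := hbt
  obtain ⟨q₂, hq₂⟩ := htb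
  obtain ⟨M', hM'⟩ := successor_dvd_pow hq₁ hΦ0 hc hfacb hfact hGt i
  obtain ⟨N', hN'⟩ := successor_dvd_pow hq₂ hΦ0 hc hfact hfacb hGb i
  have hne : X 0 * TupleGame.slice i Gt ≠ 0 :=
    mul_ne_zero (MvPowerSeries.prime_X' k (0 : Fin (m + 1))).ne_zero
      (TupleDropAssembly.slice_ne_zero (subst Φ t) w c hc hw1 At Gt hfact hGt i hci)
  exact ⟨i, hci, X 0 * TupleGame.slice i Gt, ⟨M', N', hM', hN'⟩, hne, hP⟩

/-- **DECORATED WINNING WITH RADICAL COMPANIONS (measure form).**  States are triples `(b, t, x)` read on the position `b`; `C` is a class of honest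
pairs `(t, x)` and `μ` an ordinal measure on them.  Suppose that from every `(t, x) ∈ C` outside the target `Q` some legal move satisfies, FROM `t`, the
clause «every successor `t′` carries data `x′` with `Q (t′, x′)` or (`(t′, x′) ∈ C` and `μ` drops)».  Then from every state `(b, t, x)` with `b`, `t`
radical-equivalent, `t ≠ 0` and `(t, x) ∈ C`, the mover forces — playing on `b` — a state whose honest companion is in the target. -/
theorem DWinsTo.of_radical_measure {X : Type} (Q : MvPowerSeries (Fin (m + 1)) k × X → Prop) (C : Set (MvPowerSeries (Fin (m + 1)) k × X))
    (μ : MvPowerSeries (Fin (m + 1)) k × X → Ordinal.{0})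
    (hstep : ∀ τ ∈ C, ¬ Q τ → ∃ (Φ : Fin (m + 1) → MvPowerSeries (Fin (m + 1)) k) (w : Fin (m + 1) → ℕ),
      IsCountMove Φ w ∧ MoveClause τ.1 Φ w (fun t' => ∃ x' : X, Q (t', x') ∨ ((t', x') ∈ C ∧ μ (t', x') < μ τ)))
    {b t : MvPowerSeries (Fin (m + 1)) k} {x : X} (hbt : ∃ M N : ℕ, b ∣ t ^ (M + 1) ∧ t ∣ b ^ (N + 1)) (ht : t ≠ 0) (hC : (t, x) ∈ C) :
    DWinsTo (m := m) (fun σ : MvPowerSeries (Fin (m + 1)) k × MvPowerSeries (Fin (m + 1)) k × X => σ.1)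
      (fun σ => (∃ M N : ℕ, σ.1 ∣ σ.2.1 ^ (M + 1) ∧ σ.2.1 ∣ σ.1 ^ (N + 1)) ∧ σ.2.1 ≠ 0 ∧ Q σ.2) (b, t, x) := by
  classical
  -- the class of positions with an honest companion in `C`, measured through the companion
  refine DWinsTo.of_measure
    {σ : MvPowerSeries (Fin (m + 1)) k × MvPowerSeries (Fin (m + 1)) k × X |
      (∃ M N : ℕ, σ.1 ∣ σ.2.1 ^ (M + 1) ∧ σ.2.1 ∣ σ.1 ^ (N + 1)) ∧ σ.2.1 ≠ 0 ∧ σ.2 ∈ C}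
    (fun σ => μ σ.2) ?_ ⟨hbt, ht, hC⟩
  rintro ⟨b₁, t₁, x₁⟩ ⟨hrad, ht₁, hC₁⟩ hQ
  have hQ' : ¬ Q (t₁, x₁) := fun h => hQ ⟨hrad, ht₁, h⟩
  obtain ⟨Φ, w, hmv, hcl⟩ := hstep (t₁, x₁) hC₁ hQ'
  obtain ⟨M, N, hbt₁, htb₁⟩ := hrad
  refine ⟨Φ, w, hmv, (MoveClause.of_radical hbt₁ htb₁ ht₁ hmv hcl).mono fun b' => ?_⟩
  rintro ⟨t', hrad', ht', x', hx'⟩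
  refine ⟨(b', t', x'), rfl, ?_⟩
  rcases hx' with hq | ⟨hC', hlt⟩
  · exact Or.inl ⟨hrad', ht', hq⟩
  · exact Or.inr ⟨⟨hrad', ht', hC'⟩, hlt⟩

end TameFourTupleDrop

end Summit.ResolutionOfSingularities.ResolutionOfSingularities.Theorems

end
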